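import Literature.AnabelianGeometry.EtaleTheta.Discharge.Sec2Prop214iiiBiInversionOfModel
import Literature.AnabelianGeometry.EtaleTheta.Discharge.Sec2Prop214iiiAutInduces

/-!
# [EtTh] Prop 2.14 (iii), BI-theta `{±1}`-part at the §1 model, in the currency `RigidData.Induces` of the
# typed statement `Prop214_iii_bi` (proof-only companion)

Mochizuki, *The Étale Theta Function and its Frobenioid-theoretic Manifestations* [EtTh], Publ. RIMS 45
(2009), §2, Prop 2.14 (iii) pp.49–50 (locators `p.N` = PDF pages of the PRIMS text; bib key `MochizukiEtTh2009`):
"every automorphism of a … bi-theta environment induces an automorphism of `Π^tp_Y`, hence an automorphism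
of the set of cusps of `Y`", "`Im_N ⊇ (N·l·ℤ) ⋊ {±1}`". PROOF-ONLY companion (no `def`; seat abc-iut-L2-t2, §2
owner) of `ThetaRigidity.lean` (`RigidData.Induces`, `Prop214_iii_bi`) continuing
`Discharge/Sec2Prop214iiiBiInversionOfModel.lean` (`rigidData_exists_biIso_over_conjInversion`) in the pattern
of this seat's g3/g4 `Sec2Prop214iiiBiInduces.lean` / `Sec2Prop214iiiAutInduces.lean`
(`RigidData.exists_induces_of_right_eq_aut`).

* `RigidData.exists_conjAut` — for `φ ∈ Aut_top(Π^tp_X)` and `g ∈ Π^tp_X`, the conjugated automorphism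
  `x ↦ g·φ(g⁻¹ x g)·g⁻¹` as a bi-continuous automorphism of `Π^tp_X`; it preserves `Π^tp_Y` when `φ` does
  (`map_PiY_eq_of_conjAut`).
* **`rigidData_exists_biIso_induces_conjInversion`** — at `R = C.rigidData μ hC hS h15 L`, from the inversion
  datum of `Sec2Prop214iiiBiInversionOfModel.lean` (cocycle-level `hιF`): every mod-`N` theta cocycle `η` admits
  `σ ∈ Π^tp_X̲̲`, `α ∈ Aut(B_N(η))` and `a : Π^tp_Y̲̲ ≃ₜ* Π^tp_Y̲̲` with `R.Induces α a` and `a = σ·ι(σ⁻¹ · σ)·σ⁻¹` on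
  `Π^tp_Y̲̲`. Hence the typed `⊇`-clause of `Prop214_iii_bi` at `ε = −1` is REDUCED to the cusp-LABEL clause
  `R.ActsOnCuspsBy a s (−1)` for this `a` — interface input (`C.CuspLabels` carries no equivariance axiom);
  `…_tower` at every level of a `CyclotomeTower`.
HONEST FRAMING: [EtTh] is refereed; OUR kernel checks at the cell's §1 model; no side is taken on [IUTchIII]
Cor 3.12; typed ≠ discharged elsewhere.
-/

noncomputable section

namespace Literature.AnabelianGeometry.EtaleTheta

open Literature.AnabelianGeometry.SemiGraphs

universe u

namespace RigidData

variable {N : ℕ+} {l : ℕ} (R : RigidData.{u} N l)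

/-- **The conjugated automorphism** `x ↦ g·φ(g⁻¹ x g)·g⁻¹` of `Π^tp_X`, for `φ ∈ Aut_top(Π^tp_X)` and `g ∈ Π^tp_X`,
as a bi-continuous automorphism (e.g. a conjugate of a lift of the inversion, Def 2.1 p.36).
[cite: MochizukiEtTh2009, Prop 2.14(iii) p.49] -/
theorem exists_conjAut (g : R.PiX) (φ : R.PiX ≃ₜ* R.PiX) :
    ∃ ψ : R.PiX ≃ₜ* R.PiX, ∀ x, ψ x = g * φ (g⁻¹ * x * g) * g⁻¹ := by
  have hc : ∀ e : R.PiX ≃ₜ* R.PiX, Continuous fun x => g * e (g⁻¹ * x * g) * g⁻¹ := fun e =>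
    (continuous_const.mul (e.continuous.comp
      ((continuous_const.mul continuous_id).mul continuous_const))).mul continuous_const
  refine ⟨{ toFun := fun x => g * φ (g⁻¹ * x * g) * g⁻¹
            invFun := fun x => g * φ.symm (g⁻¹ * x * g) * g⁻¹
            left_inv := fun x => ?_
            right_inv := fun x => ?_
            map_mul' := fun x y => ?_
            continuous_toFun := hc φ
            continuous_invFun := hc φ.symm }, fun x => rfl⟩
  · change g * φ.symm (g⁻¹ * (g * φ (g⁻¹ * x * g) * g⁻¹) * g) * g⁻¹ = x
    have h1 : g⁻¹ * (g * φ (g⁻¹ * x * g) * g⁻¹) * g = φ (g⁻¹ * x * g) := by group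
    rw [h1, ContinuousMulEquiv.symm_apply_apply]
    group
  · change g * φ (g⁻¹ * (g * φ.symm (g⁻¹ * x * g) * g⁻¹) * g) * g⁻¹ = x
    have h1 : g⁻¹ * (g * φ.symm (g⁻¹ * x * g) * g⁻¹) * g = φ.symm (g⁻¹ * x * g) := by group
    rw [h1, ContinuousMulEquiv.apply_symm_apply]
    group
  · have h1 : g⁻¹ * (x * y) * g = g⁻¹ * x * g * (g⁻¹ * y * g) := by group
    rw [h1, map_mul]
    group

/-- A conjugate of an automorphism preserving the normal subgroup `Π^tp_Y` preserves `Π^tp_Y`.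
[cite: MochizukiEtTh2009, Prop 2.14(iii) p.49] -/
theorem map_PiY_eq_of_conjAut (g : R.PiX) (φ ψ : R.PiX ≃ₜ* R.PiX)
    (hY : R.PiY.map φ.toMulEquiv.toMonoidHom = R.PiY) (hψ : ∀ x, ψ x = g * φ (g⁻¹ * x * g) * g⁻¹) :
    R.PiY.map ψ.toMulEquiv.toMonoidHom = R.PiY := by
  haveI : R.PiY.Normal := R.PiY_normal
  obtain ⟨hYm, hYm'⟩ := R.toThetaEnvData.mem_and_symm_mem_of_map_eq φ _ hY
  have key : ∀ x, x ∈ R.PiY → ψ x ∈ R.PiY := fun x hx => by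
    rw [hψ]
    exact R.PiY_normal.conj_mem _ (hYm _ (by
      simpa [mul_assoc] using R.PiY_normal.conj_mem _ hx g⁻¹)) g
  have key' : ∀ x, x ∈ R.PiY → ψ.symm x ∈ R.PiY := fun x hx => by
    have h1 : ψ.symm x = g * φ.symm (g⁻¹ * x * g) * g⁻¹ := by
      apply ψ.injective
      rw [ContinuousMulEquiv.apply_symm_apply, hψ]
      have h2 : g⁻¹ * (g * φ.symm (g⁻¹ * x * g) * g⁻¹) * g = φ.symm (g⁻¹ * x * g) := by group
      rw [h2, ContinuousMulEquiv.apply_symm_apply]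
      group
    rw [h1]
    exact R.PiY_normal.conj_mem _ (hYm' _ (by
      simpa [mul_assoc] using R.PiY_normal.conj_mem _ hx g⁻¹)) g
  ext x
  constructor
  · rintro ⟨y, hy, rfl⟩
    exact key y hy
  · intro hx
    exact ⟨ψ.symm x, key' x hx, ψ.apply_symm_apply x⟩

end RigidData

namespace ThetaSetting.EtaleThetaData.DoubleUnderline

variable {p : ℕ} [Fact p.Prime] {D : ThetaSetting p} {E : D.EtaleThetaData} {l : ℕ}
  (C : E.DoubleUnderline l) {N : ℕ+} (μ : D.CyclotomeMod l N) (ι : D.PiTemp ≃ₜ* D.PiTemp)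

/-- **[EtTh] Prop 2.14 (iii), BI `{±1}`-part AT THE §1 MODEL, `Induces` form.** For `R = C.rigidData μ hC hS h15 L`
and the inversion datum of `Sec2Prop214iiiBiInversionOfModel.lean` (cocycle-level `hιF`): every theta cocycle `η`
admits `σ ∈ Π^tp_X̲̲`, `α ∈ Aut(B_N(η))` and `a : Π^tp_Y̲̲ ≃ₜ* Π^tp_Y̲̲` with `R.Induces α a` and
`a(y) = σ·ι(σ⁻¹ y σ)·σ⁻¹`. The typed `⊇`-clause of `Prop214_iii_bi` at `ε = −1` then reduces to the LABEL clause
`R.ActsOnCuspsBy a s (−1)` (interface input). [cite: MochizukiEtTh2009, Prop 2.14(iii) p.50] -/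
theorem rigidData_exists_biIso_induces_conjInversion (c : ThetaCompanion ι) (h : Thm16i ι)
    (hι : C.Huu.map ι.toMulEquiv.toMonoidHom = C.Huu) (φ : ↥C.Huu ≃ₜ* ↥C.Huu)
    (hφ : ∀ x : C.Huu, ((φ x : C.Huu) : D.PiTemp) = ι x) (hC : D.Compat) (hS : D.Sec2Hyps)
    (h15 : Prop15iii E hC) (L : C.CuspLabels)
    (hιY : ∀ x : D.PiTemp, x ∈ D.GtpY ↔ ι x ∈ D.GtpY)
    (hιΔ : ∀ x : D.PiTemp, D.aug x = 1 ↔ D.aug (ι x) = 1)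
    (hβ : ∀ a ∈ D.DeltaTheta, c.thetaIso a = a)
    (hιF : ∃ (F : D.GtpYdd → D.DeltaTheta) (hF : F ∈ contCocycles D.toTheta D.DeltaTheta D.GtpYdd)
      (a : D.DeltaTheta), ContH1.mk F hF = E.etaDd ∧ (a : D.GtpTheta) ∈ D.lDeltaTheta l ∧
        transportFun c h F = fun g => F g * (MulAut.conjNormal (D.toTheta (g : D.PiTemp)) a * a⁻¹))
    {η : D.GtpYdd.subgroupOf C.Huu → MuN p N} (hη : η ∈ C.thetaCocycles hC μ) :
    ∃ (σ : C.Huu) (α : ((C.rigidData μ hC hS h15 L).modelBi hη).Iso ((C.rigidData μ hC hS h15 L).modelBi hη))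
      (a : (C.rigidData μ hC hS h15 L).PiY ≃ₜ* (C.rigidData μ hC hS h15 L).PiY),
      (C.rigidData μ hC hS h15 L).Induces α.e.toMulEquiv a ∧
        ∀ y : (C.rigidData μ hC hS h15 L).PiY,
          (((a y : (C.rigidData μ hC hS h15 L).PiY) : C.Huu) : D.PiTemp) =
            σ * ι ((σ : D.PiTemp)⁻¹ * ((y : C.Huu) : D.PiTemp) * σ) * (σ : D.PiTemp)⁻¹ := by
  obtain ⟨σ, α, hα⟩ := C.rigidData_exists_biIso_over_conjInversion μ ι c h hι φ hφ hC hS h15 L hιY hιΔ hβ hιF hη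
  have hY' : (C.rigidData μ hC hS h15 L).PiY.map φ.toMulEquiv.toMonoidHom = (C.rigidData μ hC hS h15 L).PiY :=
    C.map_eq_of_invariant ι φ hφ (· ∈ D.GtpY) hιY _ fun x => Subgroup.mem_subgroupOf
  obtain ⟨ψ, hψ⟩ := (C.rigidData μ hC hS h15 L).exists_conjAut σ φ
  have hYψ := (C.rigidData μ hC hS h15 L).map_PiY_eq_of_conjAut σ φ ψ hY' hψ
  have hψ' : ∀ y : C.Huu, ((ψ y : C.Huu) : D.PiTemp) =
      σ * ι ((σ : D.PiTemp)⁻¹ * (y : D.PiTemp) * σ) * (σ : D.PiTemp)⁻¹ := fun y => by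
    rw [hψ, Subgroup.coe_mul, Subgroup.coe_mul, hφ, Subgroup.coe_mul, Subgroup.coe_mul, Subgroup.coe_inv]
  have hα' : ∀ z : (C.rigidData μ hC hS h15 L).env,
      (((α.e.toMulEquiv z).right : (C.rigidData μ hC hS h15 L).PiY) : C.Huu) =
        ψ ((z.right : (C.rigidData μ hC hS h15 L).PiY) : C.Huu) := fun z =>
    Subtype.ext (by rw [hψ']; exact hα z)
  obtain ⟨a, ha, ha'⟩ := (C.rigidData μ hC hS h15 L).exists_induces_of_right_eq_aut ψ hYψ α.e.toMulEquiv hα'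
  exact ⟨σ, α, a, ha, fun y => by rw [ha', hψ']⟩

/-- **The same at every level of a `CyclotomeTower`** (`R = C.rigidData (τ.mod M) hC hS h15 L`).
[cite: MochizukiEtTh2009, Prop 2.14(iii) p.50] -/
theorem rigidData_exists_biIso_induces_conjInversion_tower {Es : Set ℕ+} (τ : D.CyclotomeTower l Es) (M : Es)
    (c : ThetaCompanion ι) (h : Thm16i ι) (hι : C.Huu.map ι.toMulEquiv.toMonoidHom = C.Huu)
    (φ : ↥C.Huu ≃ₜ* ↥C.Huu) (hφ : ∀ x : C.Huu, ((φ x : C.Huu) : D.PiTemp) = ι x)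
    (hC : D.Compat) (hS : D.Sec2Hyps) (h15 : Prop15iii E hC) (L : C.CuspLabels)
    (hιY : ∀ x : D.PiTemp, x ∈ D.GtpY ↔ ι x ∈ D.GtpY)
    (hιΔ : ∀ x : D.PiTemp, D.aug x = 1 ↔ D.aug (ι x) = 1)
    (hβ : ∀ a ∈ D.DeltaTheta, c.thetaIso a = a)
    (hιF : ∃ (F : D.GtpYdd → D.DeltaTheta) (hF : F ∈ contCocycles D.toTheta D.DeltaTheta D.GtpYdd)
      (a : D.DeltaTheta), ContH1.mk F hF = E.etaDd ∧ (a : D.GtpTheta) ∈ D.lDeltaTheta l ∧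
        transportFun c h F = fun g => F g * (MulAut.conjNormal (D.toTheta (g : D.PiTemp)) a * a⁻¹))
    {η : D.GtpYdd.subgroupOf C.Huu → MuN p M} (hη : η ∈ C.thetaCocycles hC (τ.mod M)) :
    ∃ (σ : C.Huu) (α : ((C.rigidData (τ.mod M) hC hS h15 L).modelBi hη).Iso
        ((C.rigidData (τ.mod M) hC hS h15 L).modelBi hη))
      (a : (C.rigidData (τ.mod M) hC hS h15 L).PiY ≃ₜ* (C.rigidData (τ.mod M) hC hS h15 L).PiY),
      (C.rigidData (τ.mod M) hC hS h15 L).Induces α.e.toMulEquiv a ∧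
        ∀ y : (C.rigidData (τ.mod M) hC hS h15 L).PiY,
          (((a y : (C.rigidData (τ.mod M) hC hS h15 L).PiY) : C.Huu) : D.PiTemp) =
            σ * ι ((σ : D.PiTemp)⁻¹ * ((y : C.Huu) : D.PiTemp) * σ) * (σ : D.PiTemp)⁻¹ :=
  C.rigidData_exists_biIso_induces_conjInversion (τ.mod M) ι c h hι φ hφ hC hS h15 L hιY hιΔ hβ hιF hη

end ThetaSetting.EtaleThetaData.DoubleUnderline

end Literature.AnabelianGeometry.EtaleTheta

end
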